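import Summits.QuantumFields.YangMills.Theorems.LuscherReductionDressedRitzPolyakovLiftChannelUniversality
import Summits.QuantumFields.YangMills.Theorems.LuscherReductionDressedRitzPolyakovLiftShadowPositivity
import HarnessLib

/-!
# Route `LuscherReduction`, item `DressedRitz` (stmt-QuantumFields-20205), line «polyakovlift» r5 — the EUCLIDEAN CURRENCY of S-UNIV′:
# `ChannelUniversalityAt k` ⟸ effective-mass universality of the NORMALISED CONNECTED TWO-POINT FUNCTIONS at separations `2L` and `2L + 1`

Support module (LEAD prover ym-lead-20205-polyakovlift g0; `--supports stmt-QuantumFields-20205`, helper).  The registered stub S-UNIV′ is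
`∀ k, ChannelUniversalityAt k` (tree `…PolyakovLiftChannelUniversality.lean`): clauses (A5)/(A6′) about the DRESSED channel vectors
`u_i = K_β^[L](ins φ G_i)` (`G_i = flowLiftAt 0 t g_i`) and their one-site shadows `w_i = K_B^[L](ins e₀ S_i)` (`S_i = g_i ∘ powLink L`).  Moving the dressing
across by the symmetry of the transfer operators (`l2_iterate_polar`), every datum is a NORMALISED CONNECTED CORRELATOR of the undressed insertions:

  `corr β φ G t i l := ⟨ins φ G_i, K_β^[t] (ins φ G_l)⟩ / λ₀^t`   — by the vacuum dictionary (`VacDict.tendsto_feynmanKac`) the `m → ∞` limit of the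
  free-boundary slab ratio `⟨Ĝ_iΦ_m, K^t(Ĝ_lΦ_m)⟩/⟨Φ_m, K^tΦ_m⟩`, i.e. the connected two-point function of the flowed Polyakov eigen-ratios at Euclidean
  time separation `t·a` in the vacuum of `L³ × ℤ`, the overall `e^{−tE₀}` removed;
  `n^f_il = λ₀^{2L}·corr(2L)`, `d^f_il = λ₀^{2L+1}·corr(2L+1)`, `ρ^f_i/λ₀ = corr(2L+1)_{ii}/corr(2L)_{ii}` — and the same on the one-site side with `μ₀(B)`.

So S-UNIV′ is EQUIVALENT (here: implied by; the converse is the same algebra) to `EuclideanChannelUniversalityAt k`: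
  (E5)  `corr^f_{2L+1,ii} · corr^o_{2L,ii} ≤ e^{Cλ²/L} · corr^o_{2L+1,ii} · corr^f_{2L,ii}` and conversely — the EFFECTIVE MASSES `−log(corr_{2L+1}/corr_{2L})`
        (per step, vacuum energy removed) of the fine flowed-Polyakov channel and of its one-site shadow agree to `±Cλ²/L`;
  (E6′) the normalised symmetrised off-diagonal correlators agree to `O(λ²/L)` (product form).
All powers of `λ₀`, `μ₀` cancel: the statement is about dimensionless ratios of Euclidean correlators — the form a Bałaban-type small-field analysis of the
slab path integrals (uniformly in the slab length) delivers.

* `l2_iterate_polar` — `⟨K^[a]f, K^[b]g⟩ = ⟨f, K^[a+b]g⟩` (physical `f, g`);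
* `corr` (normalised connected correlator of a family of insertions), `corr_dressed_norm` ∕ `corr_dressed_form` (the dressed Gram ∕ form numbers are
  `λ₀^{2L}corr(2L)` ∕ `λ₀^{2L+1}corr(2L+1)`);
* `EuclideanChannelUniversalityAt k`;  ★ `channelUniversality_of_euclidean : EuclideanChannelUniversalityAt k → ChannelUniversalityAt k`.

HONEST FRAMING: fixed-lattice bookkeeping on the conditional femto rung R2b1; S-UNIV′ stays OPEN; nothing here bears on infinite volume, the continuum
limit or the Clay gap.  References: M. Lüscher, U. Wolff, NPB 339 (1990) 222 [cite: LuscherWolff1990]; E. Seiler, LNP 159 [cite: SeilerLNP1982, §3].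
-/

set_option autoImplicit false

noncomputable section

open MeasureTheory Filter Topology Real
open Literature.MathematicalPhysics.QuantumFieldTheory (GaugeConfig Site gaugeTransform)
open scoped BigOperators

namespace Summit.QuantumFields.YangMills.Theorems.FemtoTransferGap.PolyakovLift

open Summit.QuantumFields.YangMills.Theorems.FemtoTransferGap

/-! ## §1 Moving the dressing across: polarised iterate symmetry -/

/-- `⟨K_β^[a] f, K_β^[b] g⟩ = ⟨f, K_β^[a+b] g⟩` for physical `f, g` (symmetry of `K_β`, induction). [folklore] -/
theorem l2_iterate_polar {M : ℕ} [NeZero M] (β : ℝ) {f g : GaugeConfig 3 M SU2 → ℝ} (hf : IsPhys f) (hg : IsPhys g) (a b : ℕ) :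
    l2 ((transferApply (L := M) β)^[a] f) ((transferApply β)^[b] g) = l2 f ((transferApply β)^[a + b] g) := by
  induction a generalizing b with
  | zero => simp
  | succ a ih =>
    rw [Function.iterate_succ_apply', l2_transferApply_comm β (isPhys_iterate_transferApply β hf a)
      (isPhys_iterate_transferApply β hg b), ← Function.iterate_succ_apply' (transferApply β) b, ih (b + 1)]
    congr 2
    omega

/-! ## §2 Normalised connected correlators and the dressed numbers -/

/-- **Normalised connected correlator** of a family of insertions `G` in the state `φ` at `t` transfer steps:
`corr β φ G t i l = ⟨ins φ G_i, K_β^[t](ins φ G_l)⟩ / λ₀(β)^t` (`λ₀ = levelValue su2Rep M β 0`; the `m → ∞` slab limit of `VacDict.tendsto_feynmanKac` with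
vacuum-subtracted insertions). [cite: LuscherWolff1990] -/
def corr {M : ℕ} [NeZero M] {k : ℕ} (β : ℝ) (φ : GaugeConfig 3 M SU2 → ℝ) (G : Fin k → (GaugeConfig 3 M SU2 → ℝ)) (t : ℕ) (i l : Fin k) : ℝ :=
  l2 (OpPlat.ins φ (G i)) ((transferApply (L := M) β)^[t] (OpPlat.ins φ (G l))) / levelValue su2Rep M β 0 ^ t

/-- The Gram number of two `m`-dressed insertions is `λ₀^{2m}·corr(2m)`. [folklore] -/
theorem corr_dressed_norm {M : ℕ} [NeZero M] {k : ℕ} {β : ℝ} (hβ : 0 < β) {φ : GaugeConfig 3 M SU2 → ℝ} (hφ : IsPhys φ)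
    {G : Fin k → (GaugeConfig 3 M SU2 → ℝ)} (hG : ∀ i, IsPhys (G i)) (m : ℕ) (i l : Fin k) :
    l2 ((transferApply (L := M) β)^[m] (OpPlat.ins φ (G i))) ((transferApply β)^[m] (OpPlat.ins φ (G l))) =
      levelValue su2Rep M β 0 ^ (2 * m) * corr β φ G (2 * m) i l := by
  have hl0 : 0 < levelValue su2Rep M β 0 := levelValue_su2Rep_pos hβ 0
  rw [corr, mul_div_cancel₀ _ (pow_ne_zero _ hl0.ne'), l2_iterate_polar β (OpPlat.isPhys_ins hφ (hG i)) (OpPlat.isPhys_ins hφ (hG l))]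
  congr 2; omega

/-- The form number of two `m`-dressed insertions is `λ₀^{2m+1}·corr(2m+1)`. [folklore] -/
theorem corr_dressed_form {M : ℕ} [NeZero M] {k : ℕ} {β : ℝ} (hβ : 0 < β) {φ : GaugeConfig 3 M SU2 → ℝ} (hφ : IsPhys φ)
    {G : Fin k → (GaugeConfig 3 M SU2 → ℝ)} (hG : ∀ i, IsPhys (G i)) (m : ℕ) (i l : Fin k) :
    l2 ((transferApply (L := M) β)^[m] (OpPlat.ins φ (G i))) (transferApply β ((transferApply β)^[m] (OpPlat.ins φ (G l)))) =
      levelValue su2Rep M β 0 ^ (2 * m + 1) * corr β φ G (2 * m + 1) i l := by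
  have hl0 : 0 < levelValue su2Rep M β 0 := levelValue_su2Rep_pos hβ 0
  rw [corr, mul_div_cancel₀ _ (pow_ne_zero _ hl0.ne'), ← Function.iterate_succ_apply' (transferApply β) m,
    l2_iterate_polar β (OpPlat.isPhys_ins hφ (hG i)) (OpPlat.isPhys_ins hφ (hG l))]
  congr 2; omega

/-! ## §3 The Euclidean form of S-UNIV′ -/

/-- **`EuclideanChannelUniversalityAt k`** — S-UNIV′ in Euclidean currency: deep in the femto window, for every lift basis and all raw vacua, with the
fine correlators `cF = corr β φ (flowLiftAt 0 (flowTime β L) ∘ g)` at separations `2L, 2L+1` (L-lattice, `dressSteps L = L`) and the one-site shadow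
correlators `cO = corr B e₀ (g · ∘ powLink L)` at the same separations: (E5) the effective-mass RATIOS `c_{2L+1,ii}/c_{2L,ii}` agree to `e^{±Cλ²/L}`;
(E6′) the normalised symmetrised off-diagonal combinations agree to `O(λ²/L)` (product form; no powers of the top values appear). [cite: LuscherWolff1990] -/
def EuclideanChannelUniversalityAt (k : ℕ) : Prop :=
  ∃ C lam0 : ℝ, 0 ≤ C ∧ 0 < lam0 ∧ ∀ lam : ℝ, 0 < lam → lam ≤ lam0 → ∃ L0 : ℕ,
    ∀ (L : ℕ) [NeZero L], L0 ≤ L → ∀ β : ℝ, InFemtoWindow lam β L →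
      ∀ φ : GaugeConfig 3 L SU2 → ℝ, IsRawVacuum β φ →
        ∀ (ω : GaugeConfig 3 1 SU2 → ℝ) (g : Fin k → (GaugeConfig 3 1 SU2 → ℝ)), LiftBasis (liftCoupling β L) k ω g →
          ∀ e₀ : GaugeConfig 3 1 SU2 → ℝ, IsRawVacuum (L := 1) (oneSiteCoupling β L) e₀ →
            let cF := corr β φ (fun i => flowLiftAt (L := L) 0 (flowTime β L) (g i))
            let cO := corr (oneSiteCoupling β L) e₀ (fun i => g i ∘ powLink L)
            let m := dressSteps L
            (∀ i : Fin k,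
              cF (2 * m + 1) i i * cO (2 * m) i i ≤ Real.exp (C * luscherLambda β L ^ 2 / L) * (cO (2 * m + 1) i i * cF (2 * m) i i) ∧
              cO (2 * m + 1) i i * cF (2 * m) i i ≤ Real.exp (C * luscherLambda β L ^ 2 / L) * (cF (2 * m + 1) i i * cO (2 * m) i i)) ∧
            (∀ i l : Fin k, i ≠ l →
              |(cF (2 * m + 1) i l - (cF (2 * m + 1) i i / cF (2 * m) i i + cF (2 * m + 1) l l / cF (2 * m) l l) / 2 * cF (2 * m) i l) *
                  (Real.sqrt (cO (2 * m) i i) * Real.sqrt (cO (2 * m) l l)) -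
                (cO (2 * m + 1) i l - (cO (2 * m + 1) i i / cO (2 * m) i i + cO (2 * m + 1) l l / cO (2 * m) l l) / 2 * cO (2 * m) i l) *
                  (Real.sqrt (cF (2 * m) i i) * Real.sqrt (cF (2 * m) l l))|
                ≤ C * (luscherLambda β L ^ 2 / L) *
                  (Real.sqrt (cF (2 * m) i i) * Real.sqrt (cF (2 * m) l l)) * (Real.sqrt (cO (2 * m) i i) * Real.sqrt (cO (2 * m) l l)))


/-! ## §4 ★ Euclidean ⟹ channel form -/

/-- `√(a^{2m}·c) = a^m·√c` for `a ≥ 0`. [folklore] -/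
theorem sqrt_pow_two_mul_mul {a c : ℝ} (ha : 0 ≤ a) (m : ℕ) : Real.sqrt (a ^ (2 * m) * c) = a ^ m * Real.sqrt c := by
  rw [Real.sqrt_mul (pow_nonneg ha _), show a ^ (2 * m) = (a ^ m) ^ 2 by ring, Real.sqrt_sq (pow_nonneg ha _)]

/-- ★★ **`EuclideanChannelUniversalityAt k → ChannelUniversalityAt k`**: the dressed Gram ∕ form numbers are `λ₀^{2L}·corr(2L)` ∕ `λ₀^{2L+1}·corr(2L+1)`
(`corr_dressed_norm/form`, both sides), and every clause of `ChannelUniversalityAt` is the corresponding Euclidean clause times the positive factor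
`(λ₀μ₀)^{2L+1}` (same constant `C`, same level `lam0`). [cite: LuscherWolff1990] -/
theorem channelUniversality_of_euclidean {k : ℕ} (h : EuclideanChannelUniversalityAt k) : ChannelUniversalityAt k := by
  obtain ⟨C, lam0, hC, hlam0, hk⟩ := h
  refine ⟨C, lam0, hC, hlam0, fun lam hlam hle => ?_⟩
  obtain ⟨L0, hL⟩ := hk lam hlam hle
  refine ⟨L0, fun L _ hL0 β hW φ hφ ω g hbasis e₀ he₀ => ?_⟩
  obtain ⟨h5, h6⟩ := hL L hL0 β hW φ hφ ω g hbasis e₀ he₀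
  -- positivity facts
  have hβ : 0 < β := zero_lt_one.trans_le hW.1
  have hΛpos : 0 < luscherLambda β L := luscherLambda_pos_of_window hlam hW
  have hLpos : (0 : ℝ) < L := Nat.cast_pos.mpr (NeZero.pos L)
  have hBpos : 0 < oneSiteCoupling β L := by
    unfold oneSiteCoupling; exact div_pos (mul_pos two_pos (pow_pos hLpos 3)) (pow_pos hΛpos 3)
  set l0 := levelValue su2Rep L β 0 with hl0
  set m0 := levelValue su2Rep 1 (oneSiteCoupling β L) 0 with hm0
  have hl0pos : 0 < l0 := levelValue_su2Rep_pos hβ 0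
  have hm0pos : 0 < m0 := levelValue_su2Rep_pos (L := 1) hBpos 0
  set m := dressSteps L with hm
  set G : Fin k → (GaugeConfig 3 L SU2 → ℝ) := fun i => flowLiftAt (L := L) 0 (flowTime β L) (g i) with hG
  set S : Fin k → (GaugeConfig 3 1 SU2 → ℝ) := fun i => g i ∘ powLink L with hS
  set cF := corr β φ G with hcF
  set cO := corr (oneSiteCoupling β L) e₀ S with hcO
  have hg : ∀ i, IsPhys (g i) := hbasis.2.2.2.2.1
  have hGi : ∀ i, IsPhys (G i) := fun i => isPhys_flowLiftAt 0 _ (hg i)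
  have hSi : ∀ i, IsPhys (S i) := fun i => isPhys_comp_powLink L (hg i)
  -- the dictionary: dressed numbers = powers of the top value × normalised correlators
  have hnF : ∀ i l : Fin k, l2 (dressedLiftFamily β φ g i) (dressedLiftFamily β φ g l) = l0 ^ (2 * m) * cF (2 * m) i l := fun i l => by
    simp only [dressedLiftFamily_apply]
    exact corr_dressed_norm hβ hφ.1 hGi m i l
  have hdF : ∀ i l : Fin k, l2 (dressedLiftFamily β φ g i) (transferApply β (dressedLiftFamily β φ g l)) =
      l0 ^ (2 * m + 1) * cF (2 * m + 1) i l := fun i l => by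
    simp only [dressedLiftFamily_apply]
    exact corr_dressed_form hβ hφ.1 hGi m i l
  have hnO : ∀ i l : Fin k, l2 (shadowFamily (oneSiteCoupling β L) L e₀ g i) (shadowFamily (oneSiteCoupling β L) L e₀ g l) =
      m0 ^ (2 * m) * cO (2 * m) i l := fun i l => by
    simp only [shadowFamily, shadowVec]
    exact corr_dressed_norm hBpos he₀.1 hSi m i l
  have hdO : ∀ i l : Fin k, l2 (shadowFamily (oneSiteCoupling β L) L e₀ g i)
      (transferApply (oneSiteCoupling β L) (shadowFamily (oneSiteCoupling β L) L e₀ g l)) = m0 ^ (2 * m + 1) * cO (2 * m + 1) i l := fun i l => by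
    simp only [shadowFamily, shadowVec]
    exact corr_dressed_form hBpos he₀.1 hSi m i l
  have hsF : ∀ i : Fin k, Real.sqrt (l2 (dressedLiftFamily β φ g i) (dressedLiftFamily β φ g i)) = l0 ^ m * Real.sqrt (cF (2 * m) i i) :=
    fun i => by rw [hnF, sqrt_pow_two_mul_mul hl0pos.le]
  have hsO : ∀ i : Fin k, Real.sqrt (l2 (shadowFamily (oneSiteCoupling β L) L e₀ g i) (shadowFamily (oneSiteCoupling β L) L e₀ g i)) =
      m0 ^ m * Real.sqrt (cO (2 * m) i i) := fun i => by rw [hnO, sqrt_pow_two_mul_mul hm0pos.le]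
  have hρF : ∀ i : Fin k, l2 (dressedLiftFamily β φ g i) (transferApply β (dressedLiftFamily β φ g i)) /
      l2 (dressedLiftFamily β φ g i) (dressedLiftFamily β φ g i) = l0 * (cF (2 * m + 1) i i / cF (2 * m) i i) := fun i => by
    rw [hdF, hnF, pow_succ, show l0 ^ (2 * m) * l0 * cF (2 * m + 1) i i = l0 ^ (2 * m) * (l0 * cF (2 * m + 1) i i) by ring,
      mul_div_mul_left _ _ (pow_ne_zero _ hl0pos.ne'), mul_div_assoc]
  have hρO : ∀ i : Fin k, l2 (shadowFamily (oneSiteCoupling β L) L e₀ g i)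
      (transferApply (oneSiteCoupling β L) (shadowFamily (oneSiteCoupling β L) L e₀ g i)) /
      l2 (shadowFamily (oneSiteCoupling β L) L e₀ g i) (shadowFamily (oneSiteCoupling β L) L e₀ g i) =
      m0 * (cO (2 * m + 1) i i / cO (2 * m) i i) := fun i => by
    rw [hdO, hnO, pow_succ, show m0 ^ (2 * m) * m0 * cO (2 * m + 1) i i = m0 ^ (2 * m) * (m0 * cO (2 * m + 1) i i) by ring,
      mul_div_mul_left _ _ (pow_ne_zero _ hm0pos.ne'), mul_div_assoc]
  have hP : 0 < l0 ^ (2 * m + 1) * m0 ^ (2 * m + 1) := mul_pos (pow_pos hl0pos _) (pow_pos hm0pos _)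
  refine ⟨fun i => ?_, fun i l hil => ?_⟩
  · -- (A5) = (E5) × (λ₀μ₀)^{2m+1}
    obtain ⟨e1, e2⟩ := h5 i
    rw [hdF, hnO, hdO, hnF]
    constructor
    · calc l0 ^ (2 * m + 1) * cF (2 * m + 1) i i * (m0 ^ (2 * m) * cO (2 * m) i i) * m0
          = (l0 ^ (2 * m + 1) * m0 ^ (2 * m + 1)) * (cF (2 * m + 1) i i * cO (2 * m) i i) := by ring
        _ ≤ (l0 ^ (2 * m + 1) * m0 ^ (2 * m + 1)) * (Real.exp (C * luscherLambda β L ^ 2 / L) * (cO (2 * m + 1) i i * cF (2 * m) i i)) :=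
            mul_le_mul_of_nonneg_left e1 hP.le
        _ = Real.exp (C * luscherLambda β L ^ 2 / L) * (m0 ^ (2 * m + 1) * cO (2 * m + 1) i i * (l0 ^ (2 * m) * cF (2 * m) i i) * l0) := by ring
    · calc m0 ^ (2 * m + 1) * cO (2 * m + 1) i i * (l0 ^ (2 * m) * cF (2 * m) i i) * l0
          = (l0 ^ (2 * m + 1) * m0 ^ (2 * m + 1)) * (cO (2 * m + 1) i i * cF (2 * m) i i) := by ring
        _ ≤ (l0 ^ (2 * m + 1) * m0 ^ (2 * m + 1)) * (Real.exp (C * luscherLambda β L ^ 2 / L) * (cF (2 * m + 1) i i * cO (2 * m) i i)) :=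
            mul_le_mul_of_nonneg_left e2 hP.le
        _ = Real.exp (C * luscherLambda β L ^ 2 / L) * (l0 ^ (2 * m + 1) * cF (2 * m + 1) i i * (m0 ^ (2 * m) * cO (2 * m) i i) * m0) := by ring
  · -- (A6′) = (E6′) × (λ₀μ₀)^{2m+1}
    have e := h6 i l hil
    rw [hdF, hρF, hρF, hnF, hsO, hsO, hdO, hρO, hρO, hnO, hsF, hsF]
    set x := cF (2 * m + 1) i l - (cF (2 * m + 1) i i / cF (2 * m) i i + cF (2 * m + 1) l l / cF (2 * m) l l) / 2 * cF (2 * m) i l with hx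
    set y := cO (2 * m + 1) i l - (cO (2 * m + 1) i i / cO (2 * m) i i + cO (2 * m + 1) l l / cO (2 * m) l l) / 2 * cO (2 * m) i l with hy
    set sF := Real.sqrt (cF (2 * m) i i) * Real.sqrt (cF (2 * m) l l) with hsFd
    set sO := Real.sqrt (cO (2 * m) i i) * Real.sqrt (cO (2 * m) l l) with hsOd
    have hP2 : l0 ^ (2 * m + 1) * m0 ^ (2 * m + 1) = l0 * m0 * (l0 ^ m * l0 ^ m) * (m0 ^ m * m0 ^ m) := by
      rw [← pow_add, ← pow_add]; ring_nf
    have hlhs : (l0 ^ (2 * m + 1) * cF (2 * m + 1) i l -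
          (l0 * (cF (2 * m + 1) i i / cF (2 * m) i i) + l0 * (cF (2 * m + 1) l l / cF (2 * m) l l)) / 2 * (l0 ^ (2 * m) * cF (2 * m) i l)) * m0 *
          (m0 ^ m * Real.sqrt (cO (2 * m) i i) * (m0 ^ m * Real.sqrt (cO (2 * m) l l))) -
        (m0 ^ (2 * m + 1) * cO (2 * m + 1) i l -
          (m0 * (cO (2 * m + 1) i i / cO (2 * m) i i) + m0 * (cO (2 * m + 1) l l / cO (2 * m) l l)) / 2 * (m0 ^ (2 * m) * cO (2 * m) i l)) * l0 *
          (l0 ^ m * Real.sqrt (cF (2 * m) i i) * (l0 ^ m * Real.sqrt (cF (2 * m) l l)))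
        = (l0 ^ (2 * m + 1) * m0 ^ (2 * m + 1)) * (x * sO - y * sF) := by
      rw [hx, hy, hsFd, hsOd, hP2]; ring
    have hrhs : C * (luscherLambda β L ^ 2 / L) * l0 * m0 * (l0 ^ m * Real.sqrt (cF (2 * m) i i) * (l0 ^ m * Real.sqrt (cF (2 * m) l l))) *
          (m0 ^ m * Real.sqrt (cO (2 * m) i i) * (m0 ^ m * Real.sqrt (cO (2 * m) l l)))
        = (l0 ^ (2 * m + 1) * m0 ^ (2 * m + 1)) * (C * (luscherLambda β L ^ 2 / L) * sF * sO) := by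
      rw [hsFd, hsOd, hP2]; ring
    rw [hlhs, hrhs, abs_mul, abs_of_pos hP]
    exact mul_le_mul_of_nonneg_left e hP.le

end Summit.QuantumFields.YangMills.Theorems.FemtoTransferGap.PolyakovLift

end
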